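/-
Copyright (c) 2026 the pub-hodgecm-mathlib formalisation cell (harness21).  Prover seat hodgecm-mathlib-K2E5-p17 (g4), Track B «K2-LIT» ∕ h413
(`stmt-HodgeConjecture-24833`), line `K2_E3_EllipticInputs`, unit U12 §L, Richardson road for (LBGL-ge3) at `N = 3` (road owner K2E3-p11 (g5), ROAD v2,
brick F″ «PARAHORIC LEVEL MEASURE», HANDS BY NAME 2026-09-04T06:00:55Z (3)), part 1 of 2: «MATRIX AND VALUATION ALGEBRA OF THE SKEW PRODUCT
`X = (1 + L z) · P̃` OVER THE ROWS `0, 1` OF `M₃`».  2026-09-04.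
-/
import Literature.NumberTheory.Automorphic.LocalFieldHaarBalls          -- ★ `primePowBall` kit: `mem_primePowBall_zero_iff`, (via AddCharConductorExponent) `mem_primePowBall_iff`, `add_mem_primePowBall`, …
import Mathlib.LinearAlgebra.Matrix.Determinant.Basic
import HarnessLib

/-!
# K2_E3 road (h413), §L — Richardson road at `N = 3`, brick F″ part 1: algebra of the level-`𝔭^j` parahoric set of `GL₃(𝒪)` as a skew product

Cell `pub/hodgecm-mathlib` (D-0151), Track B, seat K2E5-p17 (g4) (free E5 hand serving the E3 road by name); road owner K2E3-p11 (g5), §L lead K2E3-p12 (g5),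
dealer K2E3-plan (g3).  `--supports stmt-HodgeConjecture-24833 --as helper`; THEOREMS ONLY (no definition ∕ instance ∕ notation ∕ named fact ∕ `sorry`); never
imports `Cruxes/…/Lines`.  COUNT-NEUTRAL ((LBGL-ge3) ∕ (LBGL-3E) stay OPEN).  Consumer: part 2 `K2E3GL3ParahoricLevelMeasure` (the frozen head
`exists_lintegral_glInt_lowerLevel_eq`: `∫_{k ∈ GL₃(𝒪), k₂₀, k₂₁ ∈ 𝔭^j} Θ(k) dκ = c · ∫_{(𝔭^j)²} Θ(1 + L z) dz` for right-`(K ∩ P)`-invariant `Θ`).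

THE MATHEMATICS.  Write `X ∈ M₃` by its rows `a₀, a₁` (an `a : Fin 2 → Fin 3 → R`) and `c` (row `2`); `B(a) = [[a₀₀, a₀₁],[a₁₀, a₁₁]]`, `d(a) = det B(a)`,
`L z = [[0,0,0],[0,0,0],[z₀,z₁,0]]`, `P̃(a,t)` = the parabolic matrix with rows `a₀, a₁, (0,0,t)`.  The SKEW PRODUCT over the rows `0,1` is the linear map of
the last row `c = Λ_a(z₀,z₁,t) := (z·B(a), z·(a₀₂,a₁₂) + t)`, i.e. `c = Λ_a *ᵥ (z₀,z₁,t)` with `Λ_a = [[a₀₀,a₁₀,0],[a₀₁,a₁₁,0],[a₀₂,a₁₂,1]]`, `det Λ_a = d(a)`,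
and **`[a₀; a₁; Λ_a(z,t)] = (1 + L z) · P̃(a,t)`** (§1).  Over a non-archimedean local field `F` with `S = {X ∈ M₃(𝒪) | ‖det X‖ = 1}` (= `GL₃(𝒪)` read in
`M₃(F)`, ★ `val_image_glInt`) and the level set `T_j = {X₂₀, X₂₁ ∈ 𝔭^j}`:
* §2 `‖d(a)‖ = 1` is forced on `S ∩ T_j` for `j ≥ 1` (`det X ≡ X₂₂·d(a) mod 𝔭`, ultrametric), and `P̃(a,t) ∈ S` forces `‖d(a)‖ = 1` (`det P̃ = t·d(a)`);
* §3 for `‖d(a)‖ = 1` and `j ≥ 0`: **`(1 + L z)·P̃(a,t) ∈ S ∩ T_j ⟺ z ∈ (𝔭^j)² ∧ P̃(a,t) ∈ S`** (`⇒` recovers `z = n·B⁻¹ = n·adj(B)/d`).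
[WeilBNT1967, Ch. II §2 (lattices, `GL_n(𝒪)`)]; [Macdonald1971, (1.4)–(2.1) (parahoric ∕ Iwahori factorisations in `GL_n` of a local field)];
[BushnellHenniart2006, §1.1 (the balls `𝔭^j`), §7.2 (the groups `U_𝔄^j` of a hereditary order)].

HONEST LABEL: HC_CM is proved only modulo the 7 printed citations (2 remaining named inputs: hLiu418 = stmt-HodgeConjecture-24832, h413 = stmt-HodgeConjecture-24833)
until rung 0 closes; count-neutral helper.
-/

set_option autoImplicit false
set_option linter.dupNamespace false   -- `Summit.HodgeConjecture.HodgeConjecture.…` (D-0017 nested layout; lakefile exemption for Summits)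

noncomputable section

open Set Matrix ValuativeRel
open scoped NNReal MatrixGroups
open Literature.NumberTheory.Automorphic Literature.NumberTheory.Automorphic.LocalFieldHaar
open Literature.NumberTheory.GaloisRepresentations Literature.NumberTheory.GaloisRepresentations.IsNonarchimedeanLocalField

namespace Summit.HodgeConjecture.HodgeConjecture.Cruxes.H413.K2E3GL3ParahoricLevelMeasureLemmas

/-! ## §1  Matrix algebra over a commutative ring: the skew product `[a₀; a₁; Λ_a(z,t)] = (1 + L z)·P̃(a,t)` and its determinants -/

section Algebra

variable {R : Type*} [CommRing R]

/-- **The skew product identity**: the matrix with rows `a₀, a₁, (z·B(a), z·(a₀₂,a₁₂) + t)` is `(1 + L z) · P̃(a,t)`. [folklore] -/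
theorem of_rows_skewRow_eq (a : Fin 2 → Fin 3 → R) (z : Fin 2 → R) (t : R) :
    (Matrix.of ![a 0, a 1, ![z 0 * a 0 0 + z 1 * a 1 0, z 0 * a 0 1 + z 1 * a 1 1, z 0 * a 0 2 + z 1 * a 1 2 + t]] : Matrix (Fin 3) (Fin 3) R) =
      (1 + !![0, 0, 0; 0, 0, 0; z 0, z 1, 0]) * Matrix.of ![a 0, a 1, ![0, 0, t]] := by
  ext i j
  fin_cases i <;> fin_cases j <;> simp [Matrix.mul_apply, Fin.sum_univ_three, Matrix.one_apply]

/-- `det P̃(a,t) = t · d(a)` (`d(a) = a₀₀a₁₁ − a₀₁a₁₀`). [folklore] -/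
theorem det_of_rows_zero_zero (a : Fin 2 → Fin 3 → R) (t : R) :
    (Matrix.of ![a 0, a 1, ![0, 0, t]] : Matrix (Fin 3) (Fin 3) R).det = t * (a 0 0 * a 1 1 - a 0 1 * a 1 0) := by
  rw [Matrix.det_fin_three]
  simp
  ring

/-- `det (1 + L z) = 1`. [folklore] -/
theorem det_one_add_lowerRow (z : Fin 2 → R) : (1 + !![0, 0, 0; 0, 0, 0; z 0, z 1, 0] : Matrix (Fin 3) (Fin 3) R).det = 1 := by
  rw [Matrix.det_fin_three]
  simp

/-- **`det` of the skew product is `det P̃`**: `det [a₀; a₁; Λ_a(z,t)] = t · d(a)`. [folklore] -/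
theorem det_of_rows_skewRow (a : Fin 2 → Fin 3 → R) (z : Fin 2 → R) (t : R) :
    (Matrix.of ![a 0, a 1, ![z 0 * a 0 0 + z 1 * a 1 0, z 0 * a 0 1 + z 1 * a 1 1, z 0 * a 0 2 + z 1 * a 1 2 + t]] : Matrix (Fin 3) (Fin 3) R).det =
      t * (a 0 0 * a 1 1 - a 0 1 * a 1 0) := by
  rw [of_rows_skewRow_eq, Matrix.det_mul, det_one_add_lowerRow, one_mul, det_of_rows_zero_zero]

/-- The fibre map `Λ_a = [[a₀₀,a₁₀,0],[a₀₁,a₁₁,0],[a₀₂,a₁₂,1]]` acts by `Λ_a *ᵥ (z₀,z₁,t) = (z·B(a), z·(a₀₂,a₁₂) + t)`. [folklore] -/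
theorem skewMat_mulVec (a : Fin 2 → Fin 3 → R) (c : Fin 3 → R) :
    (!![a 0 0, a 1 0, 0; a 0 1, a 1 1, 0; a 0 2, a 1 2, 1] : Matrix (Fin 3) (Fin 3) R).mulVec c =
      ![c 0 * a 0 0 + c 1 * a 1 0, c 0 * a 0 1 + c 1 * a 1 1, c 0 * a 0 2 + c 1 * a 1 2 + c 2] := by
  ext i
  fin_cases i <;> simp [Matrix.mulVec, dotProduct, Fin.sum_univ_three] <;> ring

/-- The fibre map on a last row written as `(z₀, z₁, t)`: `Λ_a *ᵥ (z₀,z₁,t) = (z·B(a), z·(a₀₂,a₁₂) + t)`. [folklore] -/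
theorem skewMat_mulVec_cons (a : Fin 2 → Fin 3 → R) (z : Fin 2 → R) (t : R) :
    (!![a 0 0, a 1 0, 0; a 0 1, a 1 1, 0; a 0 2, a 1 2, 1] : Matrix (Fin 3) (Fin 3) R).mulVec ![z 0, z 1, t] =
      ![z 0 * a 0 0 + z 1 * a 1 0, z 0 * a 0 1 + z 1 * a 1 1, z 0 * a 0 2 + z 1 * a 1 2 + t] := by
  rw [skewMat_mulVec]
  simp

/-- `det Λ_a = d(a)`. [folklore] -/
theorem det_skewMat (a : Fin 2 → Fin 3 → R) :
    (!![a 0 0, a 1 0, 0; a 0 1, a 1 1, 0; a 0 2, a 1 2, 1] : Matrix (Fin 3) (Fin 3) R).det = a 0 0 * a 1 1 - a 0 1 * a 1 0 := by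
  rw [Matrix.det_fin_three]
  simp
  ring

/-- Expansion of a `3 × 3` determinant along the last row. [folklore] -/
theorem det_fin_three_lastRow (X : Matrix (Fin 3) (Fin 3) R) :
    X.det = X 2 0 * (X 0 1 * X 1 2 - X 0 2 * X 1 1) - X 2 1 * (X 0 0 * X 1 2 - X 0 2 * X 1 0) + X 2 2 * (X 0 0 * X 1 1 - X 0 1 * X 1 0) := by
  rw [Matrix.det_fin_three]
  ring

/-- Recovering `z` from `n = z·B(a)`: `n₀ a₁₁ − n₁ a₁₀ = z₀ · d(a)` (`z = n · adj B ∕ d`). [folklore] -/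
theorem skewRow_adj_fst (a : Fin 2 → Fin 3 → R) (z : Fin 2 → R) :
    (z 0 * a 0 0 + z 1 * a 1 0) * a 1 1 - (z 0 * a 0 1 + z 1 * a 1 1) * a 1 0 = z 0 * (a 0 0 * a 1 1 - a 0 1 * a 1 0) := by
  ring

/-- Recovering `z` from `n = z·B(a)`: `n₁ a₀₀ − n₀ a₀₁ = z₁ · d(a)`. [folklore] -/
theorem skewRow_adj_snd (a : Fin 2 → Fin 3 → R) (z : Fin 2 → R) :
    (z 0 * a 0 1 + z 1 * a 1 1) * a 0 0 - (z 0 * a 0 0 + z 1 * a 1 0) * a 0 1 = z 1 * (a 0 0 * a 1 1 - a 0 1 * a 1 0) := by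
  ring

/-- A matrix given by its three rows is right-multiplied row by row: `[a₀; a₁; c] · p = [a₀ ᵥ* p; a₁ ᵥ* p; c ᵥ* p]`. [folklore] -/
theorem of_rows_mul (a : Fin 2 → Fin 3 → R) (c : Fin 3 → R) (p : Matrix (Fin 3) (Fin 3) R) :
    (Matrix.of ![a 0, a 1, c] : Matrix (Fin 3) (Fin 3) R) * p = Matrix.of ![Matrix.vecMul (a 0) p, Matrix.vecMul (a 1) p, Matrix.vecMul c p] := by
  ext i j
  fin_cases i <;> simp [Matrix.mul_apply, Matrix.vecMul, dotProduct, Fin.sum_univ_three]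

end Algebra

/-! ## §2  Valuation lemmas: products into `𝔭^j`, and the two `‖d(a)‖ = 1` criteria -/

section Valuation

variable {F : Type*} [Field F] [ValuativeRel F] [TopologicalSpace F] [IsNonarchimedeanLocalField F]

/-- `𝔭^m · 𝒪 ⊆ 𝔭^m`. [cite: BushnellHenniart2006, §1.1] -/
theorem mul_mem_primePowBall_of_mem_integer {m : ℤ} {x y : F} (hx : x ∈ primePowBall F m) (hy : y ∈ 𝒪[F]) : x * y ∈ primePowBall F m := by
  rw [mem_primePowBall_iff] at hx ⊢
  rw [map_mul]
  calc normAbs F x * normAbs F y ≤ normAbs F x * 1 := by gcongr; exact normAbs_le_one_iff.2 hy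
    _ = normAbs F x := mul_one _
    _ ≤ _ := hx

/-- `𝒪 · 𝔭^m ⊆ 𝔭^m`. [cite: BushnellHenniart2006, §1.1] -/
theorem integer_mul_mem_primePowBall {m : ℤ} {x y : F} (hy : y ∈ 𝒪[F]) (hx : x ∈ primePowBall F m) : y * x ∈ primePowBall F m := by
  rw [mul_comm]; exact mul_mem_primePowBall_of_mem_integer hx hy

/-- `𝔭^m` is closed under subtraction. [cite: BushnellHenniart2006, §1.1] -/
theorem sub_mem_primePowBall {m : ℤ} {x y : F} (hx : x ∈ primePowBall F m) (hy : y ∈ primePowBall F m) : x - y ∈ primePowBall F m := by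
  rw [sub_eq_add_neg]; exact add_mem_primePowBall hx (neg_mem_primePowBall hy)

/-- `𝔭^m ⊆ 𝒪` for `m ≥ 0`. [cite: BushnellHenniart2006, §1.1] -/
theorem mem_integer_of_mem_primePowBall {m : ℤ} (hm : 0 ≤ m) {x : F} (hx : x ∈ primePowBall F m) : x ∈ 𝒪[F] :=
  mem_primePowBall_zero_iff.1 (primePowBall_antitone hm hx)

/-- `‖x‖ < 1` on `𝔭^m` for `m ≥ 1` (`‖x‖ ≤ q^{-m} ≤ q⁻¹ < 1`). [cite: BushnellHenniart2006, §1.1] -/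
theorem normAbs_lt_one_of_mem_primePowBall {m : ℤ} (hm : 1 ≤ m) {x : F} (hx : x ∈ primePowBall F m) : normAbs F x < 1 := by
  have h1 : x ∈ primePowBall F 1 := primePowBall_antitone hm hx
  rw [mem_primePowBall_iff, zpow_one] at h1
  exact lt_of_le_of_lt h1 inv_residueFieldCard_lt_one

/-- In `𝒪`: `‖x y‖ = 1 ⇒ ‖y‖ = 1`. [folklore] -/
theorem normAbs_eq_one_of_mul_eq_one_right {x y : F} (hx : x ∈ 𝒪[F]) (hy : y ∈ 𝒪[F]) (h : normAbs F (x * y) = 1) : normAbs F y = 1 := by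
  have hx1 : normAbs F x ≤ 1 := normAbs_le_one_iff.2 hx
  have hy1 : normAbs F y ≤ 1 := normAbs_le_one_iff.2 hy
  rw [map_mul] at h
  refine le_antisymm hy1 ?_
  by_contra hlt
  rw [not_le] at hlt
  have : normAbs F x * normAbs F y < 1 := by
    calc normAbs F x * normAbs F y ≤ 1 * normAbs F y := by gcongr
      _ = normAbs F y := one_mul _
      _ < 1 := hlt
  exact absurd h this.ne

/-- **Criterion 1 (`j ≥ 1` is used HERE)**: on `S ∩ T_j` the top-left `2 × 2` block is unimodular — if `X ∈ M₃(𝒪)`, `‖det X‖ = 1` and `X₂₀, X₂₁ ∈ 𝔭^j` with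
`j ≥ 1`, then `‖X₀₀X₁₁ − X₀₁X₁₀‖ = 1` (expand `det X` along the last row: the first two terms lie in `𝔭^j ⊆ 𝔭`, so `‖X₂₂·d‖ = 1` by the ultrametric
inequality, and `‖X₂₂‖, ‖d‖ ≤ 1`). [cite: Macdonald1971, (2.1)] -/
theorem normAbs_topLeftDet_eq_one {X : Matrix (Fin 3) (Fin 3) F} (hX : ∀ i j, X i j ∈ 𝒪[F]) (hdet : normAbs F X.det = 1)
    {m : ℤ} (hm : 1 ≤ m) (h20 : X 2 0 ∈ primePowBall F m) (h21 : X 2 1 ∈ primePowBall F m) :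
    normAbs F (X 0 0 * X 1 1 - X 0 1 * X 1 0) = 1 := by
  -- the three terms of the last-row expansion
  set u : F := X 2 0 * (X 0 1 * X 1 2 - X 0 2 * X 1 1) - X 2 1 * (X 0 0 * X 1 2 - X 0 2 * X 1 0) with hu
  set d : F := X 0 0 * X 1 1 - X 0 1 * X 1 0 with hd
  have hdO : d ∈ 𝒪[F] := sub_mem (mul_mem (hX 0 0) (hX 1 1)) (mul_mem (hX 0 1) (hX 1 0))
  have huP : u ∈ primePowBall F m := by
    refine sub_mem_primePowBall (mul_mem_primePowBall_of_mem_integer h20 ?_) (mul_mem_primePowBall_of_mem_integer h21 ?_)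
    · exact sub_mem (mul_mem (hX 0 1) (hX 1 2)) (mul_mem (hX 0 2) (hX 1 1))
    · exact sub_mem (mul_mem (hX 0 0) (hX 1 2)) (mul_mem (hX 0 2) (hX 1 0))
  have hu1 : normAbs F u < 1 := normAbs_lt_one_of_mem_primePowBall hm huP
  have hexp : X.det = u + X 2 2 * d := by rw [det_fin_three_lastRow X, hu, hd]
  -- `‖X₂₂ d‖ = 1`
  have hXd : normAbs F (X 2 2 * d) = 1 := by
    have hle : normAbs F (X 2 2 * d) ≤ 1 := normAbs_le_one_iff.2 (mul_mem (hX 2 2) hdO)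
    refine le_antisymm hle ?_
    by_contra hlt
    rw [not_le] at hlt
    have : normAbs F X.det < 1 := by
      rw [hexp]
      exact lt_of_le_of_lt (normAbs_add_le_max _ _) (max_lt hu1 hlt)
    exact absurd hdet this.ne
  exact normAbs_eq_one_of_mul_eq_one_right (hX 2 2) hdO hXd

/-- **Criterion 2**: if `‖t · d‖ = 1` with `t, d ∈ 𝒪` then `‖d‖ = 1`; contrapositively `P̃(a,t) ∉ S` as soon as `‖d(a)‖ ≠ 1` (`det P̃(a,t) = t·d(a)`).
[cite: Macdonald1971, (2.1)] -/
theorem normAbs_mul_ne_one_of_ne_one {t d : F} (ht : t ∈ 𝒪[F]) (hd : d ∈ 𝒪[F]) (hd1 : normAbs F d ≠ 1) : normAbs F (t * d) ≠ 1 :=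
  fun h => hd1 (normAbs_eq_one_of_mul_eq_one_right ht hd h)

/-- Division by a unimodular `d` preserves `𝔭^m`: `x ∈ 𝔭^m`, `‖d‖ = 1` ⇒ `x · d⁻¹ ∈ 𝔭^m`. [cite: BushnellHenniart2006, §1.1] -/
theorem mul_inv_mem_primePowBall_of_normAbs_eq_one {m : ℤ} {x d : F} (hx : x ∈ primePowBall F m) (hd : normAbs F d = 1) :
    x * d⁻¹ ∈ primePowBall F m := by
  rw [mem_primePowBall_iff] at hx ⊢
  rw [map_mul, map_inv₀, hd, inv_one, mul_one]
  exact hx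

end Valuation

/-! ## §3  The level set as a skew product: `(1 + L z)·P̃(a,t) ∈ S ∩ T_j ⟺ z ∈ (𝔭^j)² ∧ P̃(a,t) ∈ S` when `‖d(a)‖ = 1` -/

section SkewProduct

variable {F : Type*} [Field F] [ValuativeRel F] [TopologicalSpace F] [IsNonarchimedeanLocalField F]

omit [ValuativeRel F] [TopologicalSpace F] [IsNonarchimedeanLocalField F] in
/-- Entries of the skew product: rows `0, 1` are `a₀, a₁`; row `2` is `(z·B(a), z·(a₀₂,a₁₂) + t)`. [folklore] -/
theorem of_rows_skewRow_apply (a : Fin 2 → Fin 3 → F) (z : Fin 2 → F) (t : F) :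
    (Matrix.of ![a 0, a 1, ![z 0 * a 0 0 + z 1 * a 1 0, z 0 * a 0 1 + z 1 * a 1 1, z 0 * a 0 2 + z 1 * a 1 2 + t]] : Matrix (Fin 3) (Fin 3) F) 2 0 =
        z 0 * a 0 0 + z 1 * a 1 0 ∧
      (Matrix.of ![a 0, a 1, ![z 0 * a 0 0 + z 1 * a 1 0, z 0 * a 0 1 + z 1 * a 1 1, z 0 * a 0 2 + z 1 * a 1 2 + t]] : Matrix (Fin 3) (Fin 3) F) 2 1 =
        z 0 * a 0 1 + z 1 * a 1 1 ∧
      (Matrix.of ![a 0, a 1, ![z 0 * a 0 0 + z 1 * a 1 0, z 0 * a 0 1 + z 1 * a 1 1, z 0 * a 0 2 + z 1 * a 1 2 + t]] : Matrix (Fin 3) (Fin 3) F) 2 2 =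
        z 0 * a 0 2 + z 1 * a 1 2 + t := by
  refine ⟨?_, ?_, ?_⟩ <;> simp

/-- **The skew-product description of the level set** (`j ≥ 0`, `‖d(a)‖ = 1`): `(1 + L z)·P̃(a,t)` is integral with unit determinant and has its `(2,0), (2,1)`
entries in `𝔭^j` iff `z ∈ (𝔭^j)²` and `P̃(a,t)` is integral with unit determinant.  (`⇐`: `𝔭^j·𝒪 ⊆ 𝔭^j`, `det = t·d(a)`; `⇒`: rows `0,1` give `a ∈ 𝒪^{2×3}`,
`z₀ = (n₀a₁₁ − n₁a₁₀)/d`, `z₁ = (n₁a₀₀ − n₀a₀₁)/d` with `‖d‖ = 1`, `t = X₂₂ − z·(a₀₂,a₁₂)`.) [cite: Macdonald1971, (1.4), (2.1)] [cite: WeilBNT1967, Ch. II §2] -/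
theorem skewRow_mem_iff (a : Fin 2 → Fin 3 → F) (z : Fin 2 → F) (t : F) {m : ℤ} (hm : 0 ≤ m) (hd : normAbs F (a 0 0 * a 1 1 - a 0 1 * a 1 0) = 1) :
    ((Matrix.of ![a 0, a 1, ![z 0 * a 0 0 + z 1 * a 1 0, z 0 * a 0 1 + z 1 * a 1 1, z 0 * a 0 2 + z 1 * a 1 2 + t]] : Matrix (Fin 3) (Fin 3) F) ∈
          {X : Matrix (Fin 3) (Fin 3) F | (∀ i j, X i j ∈ 𝒪[F]) ∧ normAbs F X.det = 1} ∧
        (Matrix.of ![a 0, a 1, ![z 0 * a 0 0 + z 1 * a 1 0, z 0 * a 0 1 + z 1 * a 1 1, z 0 * a 0 2 + z 1 * a 1 2 + t]] : Matrix (Fin 3) (Fin 3) F) 2 0 ∈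
          primePowBall F m ∧
        (Matrix.of ![a 0, a 1, ![z 0 * a 0 0 + z 1 * a 1 0, z 0 * a 0 1 + z 1 * a 1 1, z 0 * a 0 2 + z 1 * a 1 2 + t]] : Matrix (Fin 3) (Fin 3) F) 2 1 ∈
          primePowBall F m) ↔
      ((∀ i, z i ∈ primePowBall F m) ∧
        (Matrix.of ![a 0, a 1, ![0, 0, t]] : Matrix (Fin 3) (Fin 3) F) ∈ {X : Matrix (Fin 3) (Fin 3) F | (∀ i j, X i j ∈ 𝒪[F]) ∧ normAbs F X.det = 1}) := by
  obtain ⟨h20, h21, h22⟩ := of_rows_skewRow_apply a z t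
  simp only [Set.mem_setOf_eq, det_of_rows_skewRow, det_of_rows_zero_zero]
  rw [h20, h21]
  constructor
  · rintro ⟨⟨hint, hdet⟩, hn0, hn1⟩
    -- rows `0, 1` are `a`
    have ha : ∀ i j, a i j ∈ 𝒪[F] := by
      intro i j
      fin_cases i
      · simpa using hint 0 j
      · simpa using hint 1 j
    have hd0 : (a 0 0 * a 1 1 - a 0 1 * a 1 0) ≠ 0 := by
      intro h0; rw [h0, map_zero] at hd; exact zero_ne_one hd
    -- `z₀ = (n₀ a₁₁ − n₁ a₁₀) / d`, `z₁ = (n₁ a₀₀ − n₀ a₀₁) / d`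
    have hz0 : z 0 = ((z 0 * a 0 0 + z 1 * a 1 0) * a 1 1 - (z 0 * a 0 1 + z 1 * a 1 1) * a 1 0) * (a 0 0 * a 1 1 - a 0 1 * a 1 0)⁻¹ := by
      rw [skewRow_adj_fst, mul_assoc, mul_inv_cancel₀ hd0, mul_one]
    have hz1 : z 1 = ((z 0 * a 0 1 + z 1 * a 1 1) * a 0 0 - (z 0 * a 0 0 + z 1 * a 1 0) * a 0 1) * (a 0 0 * a 1 1 - a 0 1 * a 1 0)⁻¹ := by
      rw [skewRow_adj_snd, mul_assoc, mul_inv_cancel₀ hd0, mul_one]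
    have hz0m : z 0 ∈ primePowBall F m := by
      rw [hz0]
      exact mul_inv_mem_primePowBall_of_normAbs_eq_one
        (sub_mem_primePowBall (mul_mem_primePowBall_of_mem_integer hn0 (ha 1 1)) (mul_mem_primePowBall_of_mem_integer hn1 (ha 1 0))) hd
    have hz1m : z 1 ∈ primePowBall F m := by
      rw [hz1]
      exact mul_inv_mem_primePowBall_of_normAbs_eq_one
        (sub_mem_primePowBall (mul_mem_primePowBall_of_mem_integer hn1 (ha 0 0)) (mul_mem_primePowBall_of_mem_integer hn0 (ha 0 1))) hd
    have hz : ∀ i, z i ∈ primePowBall F m := fun i => by fin_cases i <;> assumption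
    refine ⟨hz, ?_, hdet⟩
    -- `P̃(a,t)` is integral: `t = X₂₂ − z·(a₀₂, a₁₂)`
    have ht : t ∈ 𝒪[F] := by
      have h := hint 2 2
      rw [h22] at h
      have hzc : z 0 * a 0 2 + z 1 * a 1 2 ∈ 𝒪[F] :=
        add_mem (mul_mem (mem_integer_of_mem_primePowBall hm hz0m) (ha 0 2)) (mul_mem (mem_integer_of_mem_primePowBall hm hz1m) (ha 1 2))
      have : t = (z 0 * a 0 2 + z 1 * a 1 2 + t) - (z 0 * a 0 2 + z 1 * a 1 2) := by ring
      rw [this]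
      exact sub_mem h hzc
    intro i j
    fin_cases i
    · simpa using ha 0 j
    · simpa using ha 1 j
    · fin_cases j
      · simp
      · simp
      · simpa using ht
  · rintro ⟨hz, hPint, hdet⟩
    have ha : ∀ i j, a i j ∈ 𝒪[F] := by
      intro i j
      fin_cases i
      · simpa using hPint 0 j
      · simpa using hPint 1 j
    have ht : t ∈ 𝒪[F] := by simpa using hPint 2 2
    have hz0 : z 0 ∈ 𝒪[F] := mem_integer_of_mem_primePowBall hm (hz 0)
    have hz1 : z 1 ∈ 𝒪[F] := mem_integer_of_mem_primePowBall hm (hz 1)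
    refine ⟨⟨?_, hdet⟩, ?_, ?_⟩
    · intro i j
      fin_cases i
      · simpa using ha 0 j
      · simpa using ha 1 j
      · fin_cases j
        · simpa using add_mem (mul_mem hz0 (ha 0 0)) (mul_mem hz1 (ha 1 0))
        · simpa using add_mem (mul_mem hz0 (ha 0 1)) (mul_mem hz1 (ha 1 1))
        · simpa using add_mem (add_mem (mul_mem hz0 (ha 0 2)) (mul_mem hz1 (ha 1 2))) ht
    · exact add_mem_primePowBall (mul_mem_primePowBall_of_mem_integer (hz 0) (ha 0 0)) (mul_mem_primePowBall_of_mem_integer (hz 1) (ha 1 0))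
    · exact add_mem_primePowBall (mul_mem_primePowBall_of_mem_integer (hz 0) (ha 0 1)) (mul_mem_primePowBall_of_mem_integer (hz 1) (ha 1 1))

/-- **Criterion 1 for a matrix given by rows** (`j ≥ 1`): if `[a₀; a₁; c] ∈ S ∩ T_j` then `‖d(a)‖ = 1`. [cite: Macdonald1971, (2.1)] -/
theorem normAbs_topLeftDet_eq_one_of_rows (a : Fin 2 → Fin 3 → F) (c : Fin 3 → F) {m : ℤ} (hm : 1 ≤ m)
    (hS : (Matrix.of ![a 0, a 1, c] : Matrix (Fin 3) (Fin 3) F) ∈ {X : Matrix (Fin 3) (Fin 3) F | (∀ i j, X i j ∈ 𝒪[F]) ∧ normAbs F X.det = 1})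
    (h20 : c 0 ∈ primePowBall F m) (h21 : c 1 ∈ primePowBall F m) :
    normAbs F (a 0 0 * a 1 1 - a 0 1 * a 1 0) = 1 := by
  have h := normAbs_topLeftDet_eq_one hS.1 hS.2 hm (by simpa using h20) (by simpa using h21)
  simpa using h

/-- **Criterion 2 for `P̃(a,t)`**: if `P̃(a,t) ∈ S` then `‖d(a)‖ = 1` (`det P̃ = t·d(a)`, `t, d(a) ∈ 𝒪`). [cite: Macdonald1971, (2.1)] -/
theorem normAbs_topLeftDet_eq_one_of_parabolic (a : Fin 2 → Fin 3 → F) (t : F)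
    (hS : (Matrix.of ![a 0, a 1, ![0, 0, t]] : Matrix (Fin 3) (Fin 3) F) ∈ {X : Matrix (Fin 3) (Fin 3) F | (∀ i j, X i j ∈ 𝒪[F]) ∧ normAbs F X.det = 1}) :
    normAbs F (a 0 0 * a 1 1 - a 0 1 * a 1 0) = 1 := by
  obtain ⟨hint, hdet⟩ := hS
  rw [det_of_rows_zero_zero] at hdet
  have ha : ∀ i j, a i j ∈ 𝒪[F] := by
    intro i j
    fin_cases i
    · simpa using hint 0 j
    · simpa using hint 1 j
  have ht : t ∈ 𝒪[F] := by simpa using hint 2 2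
  exact normAbs_eq_one_of_mul_eq_one_right ht (sub_mem (mul_mem (ha 0 0) (ha 1 1)) (mul_mem (ha 0 1) (ha 1 0))) hdet

end SkewProduct

end Summit.HodgeConjecture.HodgeConjecture.Cruxes.H413.K2E3GL3ParahoricLevelMeasureLemmas
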